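import Mathlib
import Literature.RingTheory.KrullDimension.LocalizationDimension
import HarnessLib

/-!
# Krull dimension of Laurent polynomial rings over a Noetherian ring: `dim R[ℤᵐ] ≤ dim R + m`

Route `ResolutionOfSingularities/WeightedInvariant`, door crux `HypersurfaceCentreConstruction`
(stmt-ResolutionOfSingularities-19897), e-ladder `e = 1` of `res-L1-w43-stub-10` (cell res-hironaka,
`D/res-D-pv-025/E1Skeleton.lean`, stub `stub_e1_inv_succ` «torus bookkeeping L1»).  Companion of
`Theorems/WeightedInvariantLaurentKrullDimension.lean` (`dim R + m ≤ dim R[ℤᵐ]` for every commutative ring):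
here the reverse inequality for NOETHERIAN `R` (`R[ℤᵐ] = AddMonoidAlgebra R (Fin m → ℤ)`), so that a CLOSED
torus orbit with finite stabilisers over a field `K` — whose chart ring is integral over `K[ℤᵐ]`
(`Theorems/WeightedInvariantTorusChartDimension.lean`) — has dimension exactly `m`:

* `isNoetherianRing_laurent` — `R[ℤᵐ]` is Noetherian (finite type over `R`);
* `ringKrullDim_laurentPolynomial_le` — `dim R[T;T⁻¹] ≤ dim R + 1` (a localisation of `R[X]`,
  `Polynomial.ringKrullDim_of_isNoetherianRing`, `Literature.RingTheory.KrullDimension.ringKrullDim_le_of_isLocalization`);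
* `ringKrullDim_laurent_le` — `dim R[ℤᵐ] ≤ dim R + m` (induction: `R[ℤᵐ⁺¹] ≃ (R[ℤᵐ])[T;T⁻¹]` by
  `AddMonoidAlgebra.domCongr` along `ℤᵐ⁺¹ ≃ ℤ × ℤᵐ` and `AddMonoidAlgebra.curryRingEquiv`).

Pure commutative algebra; nothing here is a claim about Hironaka's problem.  AI-written; weaker than expert
review.
-/

noncomputable section

set_option linter.dupNamespace false -- mandated namespace of this single-conjunct summit

namespace Summit.ResolutionOfSingularities.ResolutionOfSingularities.Theorems

section Laurent

variable (R : Type*) [CommRing R]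

/-- `ℤᵐ` is a finitely generated additive monoid. [folklore] -/
theorem addMonoid_fg_pi_int (m : ℕ) : AddMonoid.FG (Fin m → ℤ) := by
  rw [← AddGroup.fg_iff_addMonoid_fg, ← Module.Finite.iff_addGroup_fg]
  infer_instance

/-- The Laurent polynomial ring `R[ℤᵐ]` over a Noetherian ring is Noetherian (it is of finite type).
[folklore] -/
theorem isNoetherianRing_laurent [IsNoetherianRing R] (m : ℕ) :
    IsNoetherianRing (AddMonoidAlgebra R (Fin m → ℤ)) := by
  haveI := addMonoid_fg_pi_int m
  haveI : Algebra.FiniteType R (AddMonoidAlgebra R (Fin m → ℤ)) := inferInstance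
  exact Algebra.FiniteType.isNoetherianRing R _

/-- `dim R[T;T⁻¹] ≤ dim R + 1` for a Noetherian ring `R`: the Laurent polynomial ring is the localisation of
`R[X]` at `X`, and `dim R[X] = dim R + 1`. [folklore] -/
theorem ringKrullDim_laurentPolynomial_le [IsNoetherianRing R] :
    ringKrullDim (LaurentPolynomial R) ≤ ringKrullDim R + 1 := by
  calc ringKrullDim (LaurentPolynomial R) ≤ ringKrullDim (Polynomial R) :=
        Literature.RingTheory.KrullDimension.ringKrullDim_le_of_isLocalization
          (Submonoid.powers (Polynomial.X : Polynomial R)) (LaurentPolynomial R)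
    _ = ringKrullDim R + 1 := Polynomial.ringKrullDim_of_isNoetherianRing

/-- `R[ℤᵐ⁺¹] ≃ (R[ℤᵐ])[T;T⁻¹]` as rings (split off the last coordinate, then curry). [folklore] -/
theorem nonempty_ringEquiv_laurent_succ (m : ℕ) :
    Nonempty (AddMonoidAlgebra R (Fin (m + 1) → ℤ) ≃+*
      LaurentPolynomial (AddMonoidAlgebra R (Fin m → ℤ))) := by
  -- `ℤᵐ⁺¹ ≃+ ℤ × ℤᵐ`, last coordinate first
  let e : (Fin (m + 1) → ℤ) ≃+ ℤ × (Fin m → ℤ) :=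
    { (Fin.snocEquiv fun _ : Fin (m + 1) => ℤ).symm with
      map_add' := fun x y => by
        ext <;> simp [Fin.snocEquiv, Fin.init] }
  let e₁ : AddMonoidAlgebra R (Fin (m + 1) → ℤ) ≃+* AddMonoidAlgebra R (ℤ × (Fin m → ℤ)) :=
    (AddMonoidAlgebra.domCongr R R e).toRingEquiv
  let e₂ : AddMonoidAlgebra R (ℤ × (Fin m → ℤ)) ≃+*
      AddMonoidAlgebra (AddMonoidAlgebra R (Fin m → ℤ)) ℤ :=
    AddMonoidAlgebra.curryRingEquiv
  exact ⟨e₁.trans e₂⟩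

/-- **Krull dimension of Laurent polynomial rings over a Noetherian ring**: `dim R[ℤᵐ] ≤ dim R + m`
(induction on `m` through `R[ℤᵐ⁺¹] ≃ (R[ℤᵐ])[T;T⁻¹]` and `ringKrullDim_laurentPolynomial_le`). [folklore] -/
theorem ringKrullDim_laurent_le [IsNoetherianRing R] (m : ℕ) :
    ringKrullDim (AddMonoidAlgebra R (Fin m → ℤ)) ≤ ringKrullDim R + m := by
  induction m with
  | zero =>
    simp only [Nat.cast_zero, add_zero]
    exact (ringKrullDim_eq_of_ringEquiv
      (AddMonoidAlgebra.uniqueRingEquiv (R := R) (M := Fin 0 → ℤ))).le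
  | succ m ih =>
    haveI := isNoetherianRing_laurent R m
    obtain ⟨e⟩ := nonempty_ringEquiv_laurent_succ R m
    calc ringKrullDim (AddMonoidAlgebra R (Fin (m + 1) → ℤ))
        = ringKrullDim (LaurentPolynomial (AddMonoidAlgebra R (Fin m → ℤ))) :=
          ringKrullDim_eq_of_ringEquiv e
      _ ≤ ringKrullDim (AddMonoidAlgebra R (Fin m → ℤ)) + 1 := ringKrullDim_laurentPolynomial_le _
      _ ≤ (ringKrullDim R + m) + 1 := by gcongr
      _ = ringKrullDim R + ((m + 1 : ℕ) : WithBot ℕ∞) := by push_cast; rw [add_assoc]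

/-- Over a field: `dim K[ℤᵐ] ≤ m`. [folklore] -/
theorem ringKrullDim_laurent_le_of_field (K : Type*) [Field K] (m : ℕ) :
    ringKrullDim (AddMonoidAlgebra K (Fin m → ℤ)) ≤ m := by
  have h := ringKrullDim_laurent_le K m
  rwa [ringKrullDim_eq_zero_of_field K, zero_add] at h

end Laurent

end Summit.ResolutionOfSingularities.ResolutionOfSingularities.Theorems

end
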